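import Summits.CriticalPhenomena.Ising3DConformalLimit.Theorems.FKParityRobustnessStrandShadowTraceExpansion
import Summits.CriticalPhenomena.Ising3DConformalLimit.Theorems.FKParityRobustnessParityBoundCurrents
import Literature.Probability.LatticeModels.CurrentSwitching
import Literature.Probability.LatticeModels.LoopO1
import HarnessLib

/-!
# Two-current trace dictionary (stub `twoCurrentTraceDictionary`, line `odd-cluster-cut-exact-helper`
# of item stmt-CriticalPhenomena-14626, route `FKParityRobustness`)

Loop side and assembly.  With the current-side expansion `twoCurrentTraceExpansion`
(`FKParityRobustnessStrandShadowTraceExpansion.lean`: the double current sum of `g(E₁ ∩ trace(n₁+n₂))`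
equals `∑_{F,F′,T} 1[∂F = A] 1[∂F′ = B] g(T) ∏_e r_e(F,F′,T)`), we evaluate the edgewise product in
closed form (`dict_prod_r_eq`: `cosh^{|E₁|+|E|} t^{|F|} t^{|F′|}` times the Bernoulli(`t²`) resummation
`∑_η (t²)^{|η|}(1−t²)^{|E₁|−|η|} 1[F ∪ (F′ ∩ E₁) ∪ η = T]`, `Finset.prod_add`) and obtain the
dictionary: the trace of `n₁ + n₂` on `E₁` has the law of `F ∪ (F′ ∩ E₁) ∪ η`, `F ~ ℓ^A_{G₁,t}`,
`F′ ~ ℓ^B_{G,t}`, `η ~ Bernoulli(t²)^{⊗E₁}`, `t = tanh β`.  Theorem-only file (Aizenman 1982 §3;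
Duminil-Copin 2016, Remark 3.4; Hansen–Jiang–Klausen 2025 §2).
-/

noncomputable section

open Finset SimpleGraph
open scoped ENNReal symmDiff
open Literature.Probability.LatticeModels

namespace Summit.CriticalPhenomena.Ising3DConformalLimit.Theorems.StrandShadowOddCut

open scoped Classical

section RealSide

variable {V : Type*} [Fintype V] [DecidableEq V] {G : SimpleGraph V} [DecidableRel G.Adj]

omit [Fintype V] in
/-- For `U, T ⊆ X` and any `η`: `U ∪ η = T` iff `η ⊆ T` and `T` agrees with `U` on `X ∖ η`.
[folklore] -/
theorem dict_union_eq_iff {U T X : Finset (Sym2 V)} (η : Finset (Sym2 V)) (hU : U ⊆ X) (hT : T ⊆ X) :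
    U ∪ η = T ↔ (∀ x ∈ η, x ∈ T) ∧ ∀ x ∈ X \ η, (x ∈ T ↔ x ∈ U) := by
  constructor
  · rintro rfl
    refine ⟨fun x hx => mem_union_right U hx, fun x hx => ?_⟩
    rw [mem_sdiff] at hx
    rw [mem_union, or_iff_left hx.2]
  · rintro ⟨h1, h2⟩
    ext x
    rw [mem_union]
    by_cases hx : x ∈ η
    · exact ⟨fun _ => h1 x hx, fun _ => Or.inr hx⟩
    · rw [or_iff_left hx]
      by_cases hxX : x ∈ X
      · exact (h2 x (mem_sdiff.2 ⟨hxX, hx⟩)).symm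
      · exact ⟨fun h => absurd (hU h) hxX, fun h => absurd (hT h) hxX⟩

/-- **Bernoulli resummation on `E₁`.** For `U, T ⊆ E₁`:
`∑_{η ⊆ E₁} (t²)^{|η|} (1 − t²)^{|E₁| − |η|} 1[U ∪ η = T] = ∏_{x ∈ E₁} q(x)` with
`q(x) = 1[x ∈ T]` on `U` and `q(x) = t² 1[x ∈ T] + (1 − t²) 1[x ∉ T]` off `U`
(`Finset.prod_add`). [folklore] -/
theorem dict_sum_powerset_bernoulli (s : ℝ) {E₁ U T : Finset (Sym2 V)} (hU : U ⊆ E₁) (hT : T ⊆ E₁) :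
    ∑ η ∈ E₁.powerset, (s ^ #η * (1 - s) ^ (#E₁ - #η)) * (if U ∪ η = T then (1 : ℝ) else 0) =
      ∏ x ∈ E₁, (if x ∈ U then (if x ∈ T then (1 : ℝ) else 0) else (if x ∈ T then s else 1 - s)) := by
  have hq : ∀ x ∈ E₁, (if x ∈ U then (if x ∈ T then (1 : ℝ) else 0) else (if x ∈ T then s else 1 - s)) =
      s * (if x ∈ T then 1 else 0) + (1 - s) * (if (x ∈ T ↔ x ∈ U) then 1 else 0) := by
    intro x _
    by_cases hxU : x ∈ U <;> by_cases hxT : x ∈ T <;> simp [hxU, hxT]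
  rw [prod_congr rfl hq, prod_add]
  refine sum_congr rfl fun η hη => ?_
  rw [mem_powerset] at hη
  rw [prod_mul_distrib, prod_mul_distrib, prod_const, prod_const, prod_boole, prod_boole,
    card_sdiff_of_subset hη]
  by_cases h : U ∪ η = T
  · obtain ⟨h1, h2⟩ := (dict_union_eq_iff η hU hT).1 h
    rw [if_pos h, if_pos h1, if_pos h2]
    ring
  · rw [if_neg h]
    by_cases h1 : ∀ x ∈ η, x ∈ T
    · rw [if_neg (fun h2 => h ((dict_union_eq_iff η hU hT).2 ⟨h1, h2⟩))]
      ring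
    · rw [if_neg h1]
      ring

/-- **The edgewise product in closed form.** For `F ⊆ E₁ = E(G) ∩ E(G₁)`, `F′ ⊆ E(G)`, `T ⊆ E₁`,
the product over the edges of `G` of the per-edge factors `r` equals
`cosh(β)^{|E₁|+|E|} ∑_{η ⊆ E₁} t^{|F|} t^{|F′|} (t²)^{|η|} (1−t²)^{|E₁|−|η|} 1[F ∪ (F′ ∩ E₁) ∪ η = T]`.
[folklore] -/
theorem dict_prod_r_eq {β : ℝ} (G₁ : SimpleGraph V) [DecidableRel G₁.Adj]
    (r : Finset (Sym2 V) → Finset (Sym2 V) → Finset (Sym2 V) → Sym2 V → ℝ)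
    (hr : ∀ F F' T x, r F F' T x = (if x ∈ F' then Real.tanh β else 1) *
      (if x ∈ G₁.edgeSet then Real.cosh β ^ 2 * (if x ∈ F then Real.tanh β else 1) *
          (if x ∈ F ∨ x ∈ F' then (if x ∈ T then 1 else 0)
            else (if x ∈ T then Real.tanh β ^ 2 else 1 - Real.tanh β ^ 2))
        else (if x ∈ F then 0 else 1) * Real.cosh β))
    {F F' T : Finset (Sym2 V)} (hF : F ⊆ G.edgeFinset) (hFG : (↑F : Set (Sym2 V)) ⊆ G₁.edgeSet)
    (hF' : F' ⊆ G.edgeFinset) (hT : T ⊆ G.edgeFinset.filter fun e => e ∈ G₁.edgeSet) :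
    ∏ e : G.edgeFinset, r F F' T e =
      Real.cosh β ^ (#(G.edgeFinset.filter fun e => e ∈ G₁.edgeSet) + #G.edgeFinset) *
        ∑ η ∈ (G.edgeFinset.filter fun e => e ∈ G₁.edgeSet).powerset,
          Real.tanh β ^ #F * Real.tanh β ^ #F' *
              ((Real.tanh β ^ 2) ^ #η *
                (1 - Real.tanh β ^ 2) ^ (#(G.edgeFinset.filter fun e => e ∈ G₁.edgeSet) - #η)) *
            (if F ∪ F'.filter (fun e => e ∈ G₁.edgeSet) ∪ η = T then 1 else 0) := by
  set E := G.edgeFinset with hE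
  set E₁ := E.filter fun e => e ∈ G₁.edgeSet with hE₁
  set t := Real.tanh β with ht
  set c := Real.cosh β with hc
  have hFE₁ : F ⊆ E₁ := fun x hx => mem_filter.2 ⟨hF hx, hFG hx⟩
  have hU : F ∪ F'.filter (fun e => e ∈ G₁.edgeSet) ⊆ E₁ :=
    union_subset hFE₁ fun x hx => mem_filter.2 ⟨hF' (mem_filter.1 hx).1, (mem_filter.1 hx).2⟩
  -- right side: pull the `t` powers out and resum `η`
  have hrhs : ∑ η ∈ E₁.powerset, t ^ #F * t ^ #F' * ((t ^ 2) ^ #η * (1 - t ^ 2) ^ (#E₁ - #η)) *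
      (if F ∪ F'.filter (fun e => e ∈ G₁.edgeSet) ∪ η = T then (1 : ℝ) else 0) =
      t ^ #F * t ^ #F' * ∏ x ∈ E₁, (if x ∈ F ∨ x ∈ F' then (if x ∈ T then (1 : ℝ) else 0)
        else (if x ∈ T then t ^ 2 else 1 - t ^ 2)) := by
    have hq : ∀ x ∈ E₁, (if x ∈ F ∨ x ∈ F' then (if x ∈ T then (1 : ℝ) else 0)
        else (if x ∈ T then t ^ 2 else 1 - t ^ 2)) =
        (if x ∈ F ∪ F'.filter (fun e => e ∈ G₁.edgeSet) then (if x ∈ T then (1 : ℝ) else 0)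
          else (if x ∈ T then t ^ 2 else 1 - t ^ 2)) := by
      intro x hx
      have hxG : x ∈ G₁.edgeSet := (mem_filter.1 hx).2
      have : (x ∈ F ∨ x ∈ F') ↔ x ∈ F ∪ F'.filter (fun e => e ∈ G₁.edgeSet) := by
        rw [mem_union, mem_filter]
        exact or_congr Iff.rfl ⟨fun h => ⟨h, hxG⟩, fun h => h.1⟩
      rw [if_congr this rfl rfl]
    rw [prod_congr rfl hq, ← dict_sum_powerset_bernoulli (t ^ 2) hU (mem_powerset.1 (mem_powerset.2 hT)),
      mul_sum]
    refine sum_congr rfl fun η _ => ?_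
    ring
  rw [hrhs, prod_coe_sort E (r F F' T)]
  -- left side: split `r = (t or 1) · rest` and the rest along `E₁ ⊔ (E ∖ E₁)`
  have hr2 : ∀ x ∈ E, r F F' T x = (if x ∈ F' then t else 1) *
      (if x ∈ G₁.edgeSet then c ^ 2 * ((if x ∈ F then t else 1) *
        (if x ∈ F ∨ x ∈ F' then (if x ∈ T then 1 else 0) else (if x ∈ T then t ^ 2 else 1 - t ^ 2)))
        else c) := by
    intro x _
    rw [hr]
    by_cases hm : x ∈ G₁.edgeSet
    · rw [if_pos hm, if_pos hm, mul_assoc]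
    · have hxF : x ∉ F := fun h => hm (hFG h)
      rw [if_neg hm, if_neg hm, if_neg hxF, one_mul]
  rw [prod_congr rfl hr2, prod_mul_distrib, prod_ite, prod_const, prod_const_one, mul_one,
    filter_mem_eq_inter, (inter_eq_right (s := F') (t := E)).2 hF',
    ← prod_filter_mul_prod_filter_not E (fun x => x ∈ G₁.edgeSet)]
  rw [prod_congr rfl fun x hx => if_pos (mem_filter.1 hx).2,
    prod_congr (s₂ := E.filter fun x => x ∉ G₁.edgeSet) rfl fun x hx => if_neg (mem_filter.1 hx).2,
    prod_const, prod_mul_distrib, prod_const, prod_mul_distrib, prod_ite, prod_const, prod_const_one,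
    mul_one, filter_mem_eq_inter, (inter_eq_right (s := F) (t := E₁)).2 hFE₁]
  have hcard : #E₁ + #(E.filter fun x => x ∉ G₁.edgeSet) = #E :=
    Finset.card_filter_add_card_filter_not (fun x => x ∈ G₁.edgeSet)
  have hpow : (c ^ 2) ^ #E₁ * c ^ #(E.filter fun x => x ∉ G₁.edgeSet) = c ^ (#E₁ + #E) := by
    rw [← pow_mul, ← pow_add]
    congr 1
    omega
  rw [← hpow]
  ring

end RealSide


section Chains

variable {V : Type*} [Fintype V] [DecidableEq V] {G : SimpleGraph V} [DecidableRel G.Adj]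

/-- If `F ⊄ E(G₁)` the edgewise product vanishes (an edge of `F` off `E(G₁)` has factor `0`).
[folklore] -/
theorem dict_prod_r_zero {β : ℝ} (G₁ : SimpleGraph V) [DecidableRel G₁.Adj]
    (r : Finset (Sym2 V) → Finset (Sym2 V) → Finset (Sym2 V) → Sym2 V → ℝ)
    (hr : ∀ F F' T x, r F F' T x = (if x ∈ F' then Real.tanh β else 1) *
      (if x ∈ G₁.edgeSet then Real.cosh β ^ 2 * (if x ∈ F then Real.tanh β else 1) *
          (if x ∈ F ∨ x ∈ F' then (if x ∈ T then 1 else 0)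
            else (if x ∈ T then Real.tanh β ^ 2 else 1 - Real.tanh β ^ 2))
        else (if x ∈ F then 0 else 1) * Real.cosh β))
    {F : Finset (Sym2 V)} (F' T : Finset (Sym2 V)) (hF : F ⊆ G.edgeFinset)
    (hFG : ¬ (↑F : Set (Sym2 V)) ⊆ G₁.edgeSet) : ∏ e : G.edgeFinset, r F F' T e = 0 := by
  obtain ⟨x, hxF, hxG⟩ := Set.not_subset.1 hFG
  refine prod_eq_zero (mem_univ ⟨x, hF hxF⟩) ?_
  rw [hr, if_neg hxG, if_pos (Finset.mem_coe.1 hxF), zero_mul, mul_zero]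

/-- **The loop side.** Expanding `g(F ∪ (F′ ∩ E₁) ∪ η)` along the value `T` of its argument and
using the closed form of the edgewise product (`dict_prod_r_eq`): the loop-O(1)/Bernoulli triple
sum equals the same `∑_{F, F′, T} 1[∂F = A] 1[∂F′ = B] g(T) ∏_e r_e(F, F′, T)`. [folklore] -/
theorem dict_rhs {β : ℝ} (hβ : 0 ≤ β) (G₁ : SimpleGraph V) [DecidableRel G₁.Adj] (A B : Finset V)
    (g : Finset (Sym2 V) → ℝ≥0∞)
    (r : Finset (Sym2 V) → Finset (Sym2 V) → Finset (Sym2 V) → Sym2 V → ℝ)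
    (hr : ∀ F F' T x, r F F' T x = (if x ∈ F' then Real.tanh β else 1) *
      (if x ∈ G₁.edgeSet then Real.cosh β ^ 2 * (if x ∈ F then Real.tanh β else 1) *
          (if x ∈ F ∨ x ∈ F' then (if x ∈ T then 1 else 0)
            else (if x ∈ T then Real.tanh β ^ 2 else 1 - Real.tanh β ^ 2))
        else (if x ∈ F then 0 else 1) * Real.cosh β)) :
    ENNReal.ofReal (Real.cosh β ^ (#(G.edgeFinset.filter fun e => e ∈ G₁.edgeSet) + #G.edgeFinset)) *
        ∑ F ∈ tJoins G G₁.edgeSet A, ∑ F' ∈ tJoins G Set.univ B,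
          ∑ η ∈ (G.edgeFinset.filter fun e => e ∈ G₁.edgeSet).powerset,
            ENNReal.ofReal (Real.tanh β ^ #F * Real.tanh β ^ #F' *
                ((Real.tanh β ^ 2) ^ #η *
                  (1 - Real.tanh β ^ 2) ^ (#(G.edgeFinset.filter fun e => e ∈ G₁.edgeSet) - #η))) *
              g (F ∪ F'.filter (fun e => e ∈ G₁.edgeSet) ∪ η) =
      ∑ F ∈ G.edgeFinset.powerset, ∑ F' ∈ G.edgeFinset.powerset,
        ∑ T ∈ (G.edgeFinset.filter fun e => e ∈ G₁.edgeSet).powerset,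
          ind (∀ v, Odd #(F.filter (v ∈ ·)) ↔ v ∈ A) * ind (∀ v, Odd #(F'.filter (v ∈ ·)) ↔ v ∈ B) *
            g T * ENNReal.ofReal (∏ e : G.edgeFinset, r F F' T e) := by
  set E := G.edgeFinset with hE
  set E₁ := E.filter fun e => e ∈ G₁.edgeSet with hE₁
  set t := Real.tanh β with ht_def
  have ht : 0 ≤ Real.tanh β := by
    rw [Real.tanh_eq_sinh_div_cosh]; exact div_nonneg (Real.sinh_nonneg_iff.2 hβ) (Real.cosh_pos β).le
  have h1t := dict_one_sub_tanh_sq_nonneg β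
  have hC₀ : 0 ≤ Real.cosh β ^ (#E₁ + #E) := pow_nonneg (Real.cosh_pos β).le _
  rw [tJoins, tJoins, sum_filter, mul_sum]
  refine sum_congr rfl fun F hF => ?_
  rw [sum_filter]
  have hFE : F ⊆ E := mem_powerset.1 hF
  by_cases hFG : (↑F : Set (Sym2 V)) ⊆ G₁.edgeSet
  · by_cases hA : ∀ v, Odd #(F.filter (v ∈ ·)) ↔ v ∈ A
    · rw [if_pos ⟨hFG, hA⟩, mul_sum]
      refine sum_congr rfl fun F' hF' => ?_
      have hF'E : F' ⊆ E := mem_powerset.1 hF'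
      by_cases hB : ∀ v, Odd #(F'.filter (v ∈ ·)) ↔ v ∈ B
      · rw [if_pos ⟨Set.subset_univ _, hB⟩, ind_of_true hA, ind_of_true hB]
        have hU : F ∪ F'.filter (fun e => e ∈ G₁.edgeSet) ⊆ E₁ :=
          union_subset (fun x hx => mem_filter.2 ⟨hFE hx, hFG hx⟩)
            fun x hx => mem_filter.2 ⟨hF'E (mem_filter.1 hx).1, (mem_filter.1 hx).2⟩
        have hg : ∀ η ∈ E₁.powerset, g (F ∪ F'.filter (fun e => e ∈ G₁.edgeSet) ∪ η) =
            ∑ T ∈ E₁.powerset,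
              (if F ∪ F'.filter (fun e => e ∈ G₁.edgeSet) ∪ η = T then g T else 0) := by
          intro η hη
          rw [sum_ite_eq, if_pos (mem_powerset.2 (union_subset hU (mem_powerset.1 hη)))]
        rw [mul_sum, sum_congr rfl fun η hη => by rw [hg η hη]]
        simp_rw [mul_sum]
        rw [sum_comm]
        refine sum_congr rfl fun T hT => ?_
        rw [dict_prod_r_eq G₁ r hr hFE hFG hF'E (mem_powerset.1 hT), one_mul, one_mul,
          ENNReal.ofReal_mul hC₀, ENNReal.ofReal_sum_of_nonneg fun η _ => ?_, mul_sum, mul_sum]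
        · refine sum_congr rfl fun η _ => ?_
          by_cases h : F ∪ F'.filter (fun e => e ∈ G₁.edgeSet) ∪ η = T
          · rw [if_pos h, if_pos h, mul_one]
            ring
          · simp only [if_neg h, mul_zero, ENNReal.ofReal_zero]
        · refine mul_nonneg (mul_nonneg (mul_nonneg (pow_nonneg ht _) (pow_nonneg ht _))
            (mul_nonneg (pow_nonneg (pow_nonneg ht 2) _) (pow_nonneg h1t _))) ?_
          split_ifs
          · exact zero_le_one
          · exact le_rfl
      · rw [if_neg (fun h => hB h.2), ind_of_false hB, mul_zero]
        symm
        refine sum_eq_zero fun T _ => ?_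
        rw [mul_zero, zero_mul, zero_mul]
    · rw [if_neg (fun h => hA h.2), mul_zero]
      symm
      refine sum_eq_zero fun F' _ => sum_eq_zero fun T _ => ?_
      rw [ind_of_false hA, zero_mul, zero_mul, zero_mul]
  · rw [if_neg (fun h => hFG h.1), mul_zero]
    symm
    refine sum_eq_zero fun F' _ => sum_eq_zero fun T _ => ?_
    rw [dict_prod_r_zero G₁ r hr F' T hFE hFG, ENNReal.ofReal_zero, mul_zero]

end Chains

/-- **twoCurrentTraceDictionary** (nested two-current trace dictionary; finite graph `G`,
subgraph `G₁`, `β ≥ 0`).  For a current `n₁` supported on `E(G₁)` with `∂n₁ = A` and an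
independent current `n₂` on `G` with `∂n₂ = B`, the TRACE of `n₁ + n₂` read on `E₁ = E(G) ∩ E(G₁)`
is distributed as `F ∪ (F′ ∩ E₁) ∪ η` where `F = odd(n₁) ~ ℓ^A_{G₁,t}`, `F′ = odd(n₂) ~ ℓ^B_{G,t}`,
`η ~ Bernoulli(t²)^{⊗E₁}` independent, `t = tanh β` (per edge: `Σ_{k odd} βᵏ/k! = sinh β`,
`Σ_{k ≥ 2 even} βᵏ/k! = cosh β − 1`, and `1 − sech²β = tanh²β` for the union of the two even-positive
fields).  Written as an identity of `ℝ≥0∞`-valued sums against an arbitrary test function `g` of the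
trace. Refs: Aizenman 1982 §3; Duminil-Copin 2016 Remark 3.4; Hansen–Jiang–Klausen 2025 §2. -/
theorem twoCurrentTraceDictionary :
    ∀ (V : Type) [Fintype V] [DecidableEq V] (G : SimpleGraph V) [DecidableRel G.Adj]
      (G₁ : SimpleGraph V) [DecidableRel G₁.Adj] (β : ℝ), 0 ≤ β →
      ∀ (A B : Finset V) (g : Finset (Sym2 V) → ℝ≥0∞),
      (let E₁ : Finset (Sym2 V) := G.edgeFinset.filter fun e => e ∈ G₁.edgeSet
       let t : ℝ := Real.tanh β
       ∑' p : Current G × Current G,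
          (if Current.IsSupp G₁ p.1 ∧ p.1.sources = A then p.1.eweight (fun _ => β) else 0) *
            (if p.2.sources = B then p.2.eweight (fun _ => β) else 0) *
            g (E₁.filter fun e => e ∈ (p.1 + p.2).traced)
        = ENNReal.ofReal (Real.cosh β ^ (#E₁ + #G.edgeFinset)) *
          ∑ F ∈ tJoins G G₁.edgeSet A, ∑ F' ∈ tJoins G Set.univ B, ∑ η ∈ E₁.powerset,
            ENNReal.ofReal (t ^ #F * t ^ #F' * ((t ^ 2) ^ #η * (1 - t ^ 2) ^ (#E₁ - #η))) *
              g (F ∪ F'.filter (fun e => e ∈ G₁.edgeSet) ∪ η)) := by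
  intro V _ _ G _ G₁ _ β hβ A B g E₁ t
  exact (twoCurrentTraceExpansion V G G₁ β hβ A B g _ fun _ _ _ _ => rfl).trans
    (dict_rhs hβ G₁ A B g _ fun _ _ _ _ => rfl).symm

end Summit.CriticalPhenomena.Ising3DConformalLimit.Theorems.StrandShadowOddCut

end
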